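import Literature.Barriers.ResolutionOfSingularities.ResidualOrderUnbounded
import Mathlib.Algebra.CharP.Two
import Mathlib.FieldTheory.IsAlgClosed.AlgebraicClosure
import Mathlib.Algebra.Field.ZMod
import Mathlib.Algebra.CharP.Algebra
import Mathlib.Data.List.GetD
import HarnessLib

/-!
# Moh's Stability claim is false: a cycle of Hauser–Perlega's first example, run in the kernel

`Literature/Barriers/ResolutionOfSingularities/ResidualOrderUnboundedProofs.lean` — proofs for the
barrier file `ResidualOrderUnbounded.lean`. There `MohStabilityClaim` — Moh's Stability Theorem as
quoted, and refuted for `e ≥ 3`, by Hauser–Perlega: "Let be given a purely inseparable equation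
`f = z^{pᵉ} + F(x₁,…,xₙ) = 0` with residual order `d` and a sequence of permissible blowups under
which the order of the strict transforms of `f` remain constant. Then the residual orders of the
strict transforms of `f` cannot increase beyond the bound `d + p^{e−1}`" — is recorded as a
REFUTED named statement ("Do NOT take `(h : MohStabilityClaim)`"), with
`not_mohStabilityClaim : HauserPerlega2019 → ¬ MohStabilityClaim` conditional on the named fact
`HauserPerlega2019` (residual order → ∞ along the printed cycles). A discharge
`MohStabilityClaim_holds` is therefore impossible; instead this file makes the refutation
UNCONDITIONAL — `mohStabilityClaim_false : ¬ MohStabilityClaim` — by running an explicit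
instance of the first example of [HauserPerlega2019, §4] in the kernel: `p = 2`, `e = 3`
(`ord f = 8`), `n = 5`, `d = 2`, eleven point blow-ups, residual order `2 ↦ 8 > 2 + 2^{3−1}`.

## Part 1 — a verified list calculus for the §2 setting (five variables, characteristic `2`)

* `E5` — exponent vectors of monomials `xᵃyᵇuᶜvᵈwᵉ`, `E5.toF : Fin 5 →₀ ℕ`; a list `L : List E5`
  denotes `evalL K L = Σ_{e ∈ L} x^e` (a SUM over the list: in characteristic `2` equal entries
  cancel in pairs, so no normal form is needed and none is computed).
* `bitSubsets f m` — the `k` with `binom(m,k)` odd (binary sub-patterns of `m`), by halving;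
  `add_one_pow_eq_sum_bitSubsets`: `(X + 1)^m = Σ_k X^k` over them in characteristic `2`.
* `scaleList`, `expandCoord`, `translList`, `transformList`, `divList`, `cleanList`, `stepList`:
  list versions of `x^e ↦ x_j^{|e|}∏_{i≠j} x_i^{e_i}`, `x_i ↦ x_i + 1`, the point blow-up `π`
  (`pointBlowupSubst`, translations `tᵢ ∈ {0,1}`), Mathlib's `divMonomial`, deletion of `q`-th
  power monomials (`deletePthPowers`), and one step `F ↦ (x_j^{−q} π(F))_clean`;
  `evalL_stepList : evalL (stepList q j t L) = deletePthPowers q (transformResidual q j t (evalL L))`.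
* Reading orders off lists (`le_ordZero_evalL`, `isClean_evalL`, `toF_mem_support_evalL`: an
  entry occurring exactly once is in the support) and the generic bounds
  `natCast_le_residualOrder_of_bounds` / `residualOrder_le_natCast_of_witness` for
  `residualOrder`, packaged as `residualOrder_evalL_eq_of_cert` (residual order from a
  kernel-checkable certificate).

## Part 2 — the sequence (variables `x, y, u, v, w`; `F⁰ = x⁴y⁴w⁶(w² + x¹³)`, `E = V(xyuvw)`)

Hauser–Perlega's blow-ups (0)–(7) for `d = 2`, `a = b = r = 0`, `s = 1`, `λ = 1`, `Q = 0`, with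
the unit-carrying term `x^{d+1}u^{2d+6}·A` of the starting equation specialised to the pure power
`x¹³` (so `u` need not be translated in blow-up (1)), blow-up (7) performed `4` times (enough
for the next jump; the source performs it `2d + 10` times to restore the exact starting shape
for the infinite iteration), and the closing blow-up (1) of the second cycle translating `u` only:

| `k` | blow-up `F^k ↦ F^{k+1}` | HP step | residual order of `F^k` (PROVED, `residualOrder_cycleF`) |
|---|---|---|---|
| 0 | `x`-chart, `y ↦ y + 1` | (1) | `2 = d` |
| 1 | `x`-chart | (2) | `6 = d + 4` |
| 2 | `u`-chart | (3) | `5 = d + 3` |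
| 3 | `v`-chart | (4), `d/2 = 1` time | `5` |
| 4 | `w`-chart, `y ↦ y + 1`, `v ↦ v + 1` | (5) | `5` |
| 5 | `u`-chart | (6) | `5` |
| 6–9 | `y`-chart | (7), `4` times | `4 = d + 2` |
| 10 | `x`-chart, `u ↦ u + 1` | (1) of the next cycle | `4` |
| 11 | `v`-chart, no translation, for ever after | — | `8 = (d + 2) + 4` |

All `F^k` are clean with `ord F^k ≥ 8` (the order of `f = z⁸ + F^k` stays `8`: each point centre
is permissible and each chosen point equiconstant), `F^{k+1} = (x_j^{−8} π_k(F^k))_clean`, and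
the exceptional sets follow the printed rule `Δ' = {j} ∪ {i ∈ Δ : tᵢ = 0}`
(`cycle_isPointBlowupSequence`); `F¹¹` has `606` monomials. The twelve residual orders are
certified by one kernel computation (`cycle_certificates`, `decide`); `8 > 2 + 4` contradicts
the claimed bound (`mohStabilityClaim_false`, over an algebraic closure of `𝔽₂`; the sequence
itself is built over any commutative ring of characteristic `2`,
`exists_pointBlowupSequence_residualOrder_exceeds`). From `k = 11` on, blow-ups in the `v`-chart
without translation keep every `x`-exponent `≥ 8` (`cycleList_x_ge`), which continues the
sequence with `ord ≥ 8` as `IsPointBlowupSequence` demands.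

What is NOT claimed: that the residual order tends to infinity along this continuation (the
named fact `HauserPerlega2019` — the full cycles with `ℕ`-parametrised exponents — stays a named
fact); anything for `e ≤ 2` (the source: Moh's bound "is known to be valid for `e = 1`").
[cite: HauserPerlega2019, §2 (setting), §3 (Moh's claim; "This disproves Moh's claim in the case e ≥ 3"), §4 (First example, blow-ups (0)–(7))]
-/

namespace Literature.Barriers.ResolutionOfSingularities

open MvPolynomial Finset

open scoped BigOperators

open Literature.AlgebraicGeometry.Resolution.Hauser2010

namespace HauserPerlega

/-! ## Exponent vectors in five variables and the list calculus (computable) -/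

/-- Exponent vector `(a, b, c, d, e)` of the monomial `xᵃ yᵇ uᶜ vᵈ wᵉ` in the five variables
`x, y, u, v, w` (`= x₁, …, x₅`) of Hauser–Perlega's first example. [cite: HauserPerlega2019, §4 (First example)] -/
structure E5 where
  /-- exponent of `x = x₁` -/
  x : ℕ
  /-- exponent of `y = x₂` -/
  y : ℕ
  /-- exponent of `u = x₃` -/
  u : ℕ
  /-- exponent of `v = x₄` -/
  v : ℕ
  /-- exponent of `w = x₅` -/
  w : ℕ
deriving DecidableEq, Repr

namespace E5

/-- The `i`-th exponent (`i = 0, …, 4` for `x, y, u, v, w`; indices `≥ 4` read `w`). [folklore] -/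
def get (e : E5) : ℕ → ℕ
  | 0 => e.x
  | 1 => e.y
  | 2 => e.u
  | 3 => e.v
  | _ => e.w

/-- Replace the `i`-th exponent by `n`. [folklore] -/
def set (e : E5) : ℕ → ℕ → E5
  | 0, n => { e with x := n }
  | 1, n => { e with y := n }
  | 2, n => { e with u := n }
  | 3, n => { e with v := n }
  | _, n => { e with w := n }

/-- Total degree. [folklore] -/
def deg (e : E5) : ℕ := e.x + e.y + e.u + e.v + e.w

/-- Componentwise `s ≤ e`, as a Boolean. [folklore] -/
def ble (s e : E5) : Bool :=
  Nat.ble s.x e.x && Nat.ble s.y e.y && Nat.ble s.u e.u && Nat.ble s.v e.v && Nat.ble s.w e.w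

/-- Componentwise (truncated) difference `e - s`. [folklore] -/
def sub (e s : E5) : E5 := ⟨e.x - s.x, e.y - s.y, e.u - s.u, e.v - s.v, e.w - s.w⟩

/-- All exponents divisible by `q` (a `q`-th power monomial), as a Boolean. [folklore] -/
def isPth (q : ℕ) (e : E5) : Bool :=
  Nat.beq (e.x % q) 0 && Nat.beq (e.y % q) 0 && Nat.beq (e.u % q) 0 && Nat.beq (e.v % q) 0 &&
    Nat.beq (e.w % q) 0

/-- The exponent vector of `x_j^q`. [folklore] -/
def unitVec (j q : ℕ) : E5 := (⟨0, 0, 0, 0, 0⟩ : E5).set j q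

/-- The exponent vector as a finitely supported function on `Fin 5`. [folklore] -/
noncomputable def toF (e : E5) : Fin 5 →₀ ℕ :=
  Finsupp.single 0 e.x + Finsupp.single 1 e.y + Finsupp.single 2 e.u + Finsupp.single 3 e.v +
    Finsupp.single 4 e.w

end E5

/-- `bitSubsets f m` (for `m < 2^f`): the list of all `k` whose binary digits are a sub-pattern of
those of `m`, i.e. (Lucas) the `k ≤ m` with `binom(m, k)` odd; computed by halving `m`. [folklore] -/
def bitSubsets : ℕ → ℕ → List ℕ
  | 0, _ => [0]
  | f + 1, m =>
    if m % 2 = 1 then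
      (bitSubsets f (m / 2)).map (2 * ·) ++ ((bitSubsets f (m / 2)).map (2 * ·)).map (· + 1)
    else (bitSubsets f (m / 2)).map (2 * ·)

/-- Substitute `x_i ↦ x_i + 1` (characteristic `2`) in every monomial of the list: `x^e` becomes
the list of `x^{e'}`, `e'` = `e` with `e_i` replaced by each `k ∈ bitSubsets e_i e_i`. [folklore] -/
def expandCoord (i : Fin 5) : List E5 → List E5
  | [] => []
  | e :: L => (bitSubsets (e.get i.val) (e.get i.val)).map (e.set i.val) ++ expandCoord i L

/-- `expandCoord` if the flag is set, identity otherwise. [folklore] -/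
def procCoord (i : Fin 5) (b : Bool) (L : List E5) : List E5 :=
  match b with
  | true => expandCoord i L
  | false => L

/-- Apply the translations `x_i ↦ x_i + 1` for all `i ≠ j` with `t i = true`. [folklore] -/
def translList (j : Fin 5) (t : ℕ → Bool) (L : List E5) : List E5 :=
  procCoord 0 (t 0 && !(0 == j.val)) (procCoord 1 (t 1 && !(1 == j.val))
    (procCoord 2 (t 2 && !(2 == j.val)) (procCoord 3 (t 3 && !(3 == j.val))
      (procCoord 4 (t 4 && !(4 == j.val)) L))))

/-- The monomial substitution of the `x_j`-chart, `x_i ↦ x_j x_i (i ≠ j)`: `x^e ↦ x^{e'}` with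
`e'_j = |e|`. [cite: HauserPerlega2019, §2 (point blowup)] -/
def scaleList (j : Fin 5) (L : List E5) : List E5 := L.map fun e => e.set j.val e.deg

/-- The total transform `π(F)` of the point blow-up in the `x_j`-chart with `0/1` translations `t`,
on lists. [cite: HauserPerlega2019, §2 (point blowup)] -/
def transformList (j : Fin 5) (t : ℕ → Bool) (L : List E5) : List E5 :=
  translList j t (scaleList j L)

/-- Division by the monomial `x^s`, dropping the monomials not divisible by it (Mathlib's
`MvPolynomial.divMonomial`), on lists. [folklore] -/
def divList (s : E5) (L : List E5) : List E5 := (L.filter fun e => s.ble e).map fun e => e.sub s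

/-- Deleting the `q`-th power monomials (cleaning), on lists. [cite: HauserPerlega2019, §2 (cleaning)] -/
def cleanList (q : ℕ) (L : List E5) : List E5 := L.filter fun e => !(E5.isPth q e)

/-- One step `F ↦ (x_j^{-q} · π(F))_clean` of a point blow-up sequence, on lists.
[cite: HauserPerlega2019, §2] -/
def stepList (q : ℕ) (j : Fin 5) (t : ℕ → Bool) (L : List E5) : List E5 :=
  cleanList q (divList (E5.unitVec j.val q) (transformList j t L))

/-! ## Semantics -/

namespace E5

variable (e : E5)

/-- `x`-exponent. [folklore] -/
@[simp] theorem toF_apply_zero : e.toF 0 = e.x := by simp [toF]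
/-- `y`-exponent. [folklore] -/
@[simp] theorem toF_apply_one : e.toF 1 = e.y := by simp [toF]
/-- `u`-exponent. [folklore] -/
@[simp] theorem toF_apply_two : e.toF 2 = e.u := by simp [toF]
/-- `v`-exponent. [folklore] -/
@[simp] theorem toF_apply_three : e.toF 3 = e.v := by simp [toF]
/-- `w`-exponent. [folklore] -/
@[simp] theorem toF_apply_four : e.toF 4 = e.w := by simp [toF]

/-- `toF` is injective. [folklore] -/
theorem toF_inj (e e' : E5) : e.toF = e'.toF ↔ e = e' := by
  constructor
  · intro h
    have h0 := DFunLike.congr_fun h 0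
    have h1 := DFunLike.congr_fun h 1
    have h2 := DFunLike.congr_fun h 2
    have h3 := DFunLike.congr_fun h 3
    have h4 := DFunLike.congr_fun h 4
    simp only [toF_apply_zero, toF_apply_one, toF_apply_two, toF_apply_three, toF_apply_four]
      at h0 h1 h2 h3 h4
    cases e; cases e'; simp_all
  · rintro rfl; rfl

/-- The `i`-th exponent read through `toF`. [folklore] -/
theorem toF_apply (i : Fin 5) : e.toF i = e.get i.val := by
  fin_cases i <;> simp [get]

/-- The degree of `toF e` is the total degree. [folklore] -/
theorem degree_toF : e.toF.degree = e.deg := by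
  rw [Finsupp.degree_eq_sum, Fin.sum_univ_five]
  simp [deg]

/-- Exponents after `set`. [folklore] -/
theorem toF_set_apply (i l : Fin 5) (n : ℕ) :
    (e.set i.val n).toF l = if l = i then n else e.toF l := by
  fin_cases i <;> fin_cases l <;> simp [set, get, toF_apply]

/-- `set` at an index `≠ 0` does not change the `x`-exponent. [folklore] -/
theorem x_set_of_ne_zero {j : ℕ} (hj : j ≠ 0) (n : ℕ) : (e.set j n).x = e.x := by
  rcases j with _ | _ | _ | _ | _ | j
  · exact absurd rfl hj
  all_goals rfl

/-- `ble` is the componentwise order. [folklore] -/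
theorem ble_eq_true_iff (s : E5) : s.ble e = true ↔ s.toF ≤ e.toF := by
  rw [Finsupp.le_def]
  constructor
  · intro h i
    simp only [ble, Bool.and_eq_true, Nat.ble_eq] at h
    fin_cases i <;> simp [h]
  · intro h
    have h0 := h 0; have h1 := h 1; have h2 := h 2; have h3 := h 3; have h4 := h 4
    simp only [toF_apply_zero, toF_apply_one, toF_apply_two, toF_apply_three,
      toF_apply_four] at h0 h1 h2 h3 h4
    simp [ble, Nat.ble_eq, *]

/-- Characterisation of `e = s + m` (as exponent vectors) by the list operations. [folklore] -/
theorem toF_eq_add_iff (s : E5) (m : Fin 5 →₀ ℕ) :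
    e.toF = s.toF + m ↔ s.ble e = true ∧ (e.sub s).toF = m := by
  constructor
  · intro h
    have hle : s.toF ≤ e.toF := by rw [h]; exact le_self_add
    refine ⟨(ble_eq_true_iff e s).2 hle, ?_⟩
    ext i
    have hi := DFunLike.congr_fun h i
    simp only [Finsupp.coe_add, Pi.add_apply] at hi
    fin_cases i <;> simp [sub] at hi ⊢ <;> omega
  · rintro ⟨hb, hm⟩
    rw [ble_eq_true_iff, Finsupp.le_def] at hb
    have h0 := hb 0; have h1 := hb 1; have h2 := hb 2; have h3 := hb 3; have h4 := hb 4
    simp only [toF_apply_zero, toF_apply_one, toF_apply_two, toF_apply_three,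
      toF_apply_four] at h0 h1 h2 h3 h4
    ext i
    have hi := DFunLike.congr_fun hm i
    simp only [Finsupp.coe_add, Pi.add_apply]
    fin_cases i <;> simp [sub] at hi ⊢ <;> omega

/-- `isPth` decides `IsPthPowerExponent`. [folklore] -/
theorem isPth_eq_true_iff (q : ℕ) : e.isPth q = true ↔ IsPthPowerExponent q e.toF := by
  rw [isPthPowerExponent_iff]
  constructor
  · intro h i
    simp only [isPth, Bool.and_eq_true, Nat.beq_eq] at h
    fin_cases i <;> simp <;> omega
  · intro h
    have h0 := h 0; have h1 := h 1; have h2 := h 2; have h3 := h 3; have h4 := h 4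
    simp only [toF_apply_zero, toF_apply_one, toF_apply_two, toF_apply_three,
      toF_apply_four] at h0 h1 h2 h3 h4
    simp only [isPth, Bool.and_eq_true, Nat.beq_eq]
    omega

/-- `unitVec j q` is the exponent of `x_j^q`. [folklore] -/
theorem toF_unitVec (j : Fin 5) (q : ℕ) : (unitVec j.val q).toF = Finsupp.single j q := by
  ext l
  fin_cases j <;> fin_cases l <;> simp [unitVec, set]

end E5

/-! ### `(X + 1)^m` in characteristic two -/

/-- **Lucas in characteristic `2`, computably**: `(X + 1)^m = Σ_{k ∈ bitSubsets f m} X^k` whenever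
`m < 2^f`. [folklore] -/
theorem add_one_pow_eq_sum_bitSubsets {R : Type*} [CommSemiring R] [CharP R 2] (X : R) :
    ∀ (f m : ℕ), m < 2 ^ f → (X + 1) ^ m = ((bitSubsets f m).map (X ^ ·)).sum
  | 0, m, h => by
    have hm : m = 0 := by simpa using h
    subst hm
    simp [bitSubsets]
  | f + 1, m, h => by
    have hm : m / 2 < 2 ^ f := by
      rw [Nat.div_lt_iff_lt_mul two_pos]; simpa [pow_succ] using h
    have ih := add_one_pow_eq_sum_bitSubsets X f (m / 2) hm
    have hsq : (((bitSubsets f (m / 2)).map (2 * ·)).map (X ^ ·)).sum = ((X + 1) ^ (m / 2)) ^ 2 := by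
      rw [ih, CharTwo.list_sum_sq, List.map_map, List.map_map]
      congr 1
      apply List.map_congr_left
      intro k _
      simp [pow_mul, pow_right_comm]
    have hdecomp : (X + 1) ^ m = ((X + 1) ^ (m / 2)) ^ 2 * (X + 1) ^ (m % 2) := by
      rw [← pow_mul, ← pow_add]
      congr 1
      omega
    rw [hdecomp, bitSubsets]
    split_ifs with hodd
    · rw [hodd, pow_one, List.map_append, List.sum_append, hsq]
      have : (((bitSubsets f (m / 2)).map (2 * ·)).map (· + 1)).map (X ^ ·) =
          ((bitSubsets f (m / 2)).map (2 * ·)).map (fun k => X ^ k * X) := by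
        rw [List.map_map]
        apply List.map_congr_left
        intro k _
        simp [pow_succ]
      rw [this, List.sum_map_mul_right, hsq]; ring
    · have h0 : m % 2 = 0 := by omega
      rw [h0, pow_zero, mul_one, hsq]

/-! ### The denotation of a list and its coefficients -/

section Semantics

variable (K : Type*) [CommRing K]

/-- The polynomial denoted by a list of exponent vectors: `Σ_{e ∈ L} x^e` (with multiplicity; in
characteristic `2` equal entries cancel in pairs). [folklore] -/
noncomputable def evalL (L : List E5) : MvPolynomial (Fin 5) K :=
  (L.map fun e => monomial e.toF (1 : K)).sum

/-- Denotation of the empty list. [folklore] -/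
@[simp] theorem evalL_nil : evalL K [] = 0 := by simp [evalL]

/-- Denotation of a cons. [folklore] -/
@[simp] theorem evalL_cons (e : E5) (L : List E5) :
    evalL K (e :: L) = monomial e.toF 1 + evalL K L := by simp [evalL]

/-- Denotation of an append. [folklore] -/
@[simp] theorem evalL_append (L M : List E5) : evalL K (L ++ M) = evalL K L + evalL K M := by
  simp [evalL, List.sum_append]

/-- Denotation of a mapped list. [folklore] -/
theorem evalL_map {α : Type*} (g : α → E5) (S : List α) :
    evalL K (S.map g) = (S.map fun a => monomial (g a).toF (1 : K)).sum := by
  simp [evalL, List.map_map, Function.comp_def]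

variable {K}

/-- **Coefficients of a denotation**: the coefficient of `x^d` is the number of entries `e` of the
list with `toF e = d`. [folklore] -/
theorem coeff_evalL (L : List E5) (d : Fin 5 →₀ ℕ) :
    coeff d (evalL K L) = (L.countP fun e => e.toF = d : ℕ) := by
  induction L with
  | nil => simp
  | cons e L ih =>
    rw [evalL_cons, coeff_add, coeff_monomial, ih, List.countP_cons]
    by_cases h : e.toF = d <;> simp [h, add_comm]

/-- A monomial of the denotation comes from an entry of the list. [folklore] -/
theorem exists_mem_of_mem_support_evalL {L : List E5} {d : Fin 5 →₀ ℕ}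
    (h : d ∈ (evalL K L).support) : ∃ e ∈ L, e.toF = d := by
  rw [MvPolynomial.mem_support_iff, coeff_evalL] at h
  have h' : (L.countP fun e => e.toF = d) ≠ 0 := fun h0 => h (by rw [h0]; simp)
  obtain ⟨e, he, hed⟩ := List.countP_pos_iff.1 (Nat.pos_of_ne_zero h')
  exact ⟨e, he, by simpa using hed⟩

/-- An entry occurring exactly once has coefficient `1`. [folklore] -/
theorem coeff_evalL_of_count_eq_one {L : List E5} {e : E5} (h : L.count e = 1) :
    coeff e.toF (evalL K L) = 1 := by
  rw [coeff_evalL]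
  have : (L.countP fun e' => e'.toF = e.toF) = L.count e := by
    rw [List.count_eq_countP]
    apply List.countP_congr
    intro e' _
    simp [E5.toF_inj]
  rw [this, h, Nat.cast_one]

/-- An entry occurring exactly once is in the support (over a nontrivial ring). [folklore] -/
theorem toF_mem_support_evalL [Nontrivial K] {L : List E5} {e : E5} (h : L.count e = 1) :
    e.toF ∈ (evalL K L).support := by
  rw [MvPolynomial.mem_support_iff, coeff_evalL_of_count_eq_one h]
  exact one_ne_zero

/-! ### The two elementary substitutions as algebra maps -/

variable (K)

/-- The translation `x_i ↦ x_i + c` (other variables fixed).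
[cite: HauserPerlega2019, §2 (translations `xᵢ → xᵢ + tᵢ`)] -/
noncomputable def transl (i : Fin 5) (c : K) :
    MvPolynomial (Fin 5) K →ₐ[K] MvPolynomial (Fin 5) K :=
  aeval fun l => if l = i then X i + C c else X l

/-- The monomial part of the `x_j`-chart: `x_j ↦ x_j`, `x_l ↦ x_j x_l` (`l ≠ j`).
[cite: HauserPerlega2019, §2 (point blowup)] -/
noncomputable def scaleHom (j : Fin 5) : MvPolynomial (Fin 5) K →ₐ[K] MvPolynomial (Fin 5) K :=
  aeval fun l => if l = j then X j else X j * X l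

/-- `0/1` as ring elements. [folklore] -/
def cK (b : Bool) : K := if b then 1 else 0

/-- The translation vector `t : Fin 5 → K` with entries in `{0, 1}` encoded by Booleans.
[cite: HauserPerlega2019, §2] -/
def tK (t : ℕ → Bool) : Fin 5 → K := fun i => cK K (t i.val)

/-- All the translations of one point blow-up: `x_l ↦ x_l + 1` for `l ≠ j` with `t l`.
[cite: HauserPerlega2019, §2] -/
noncomputable def translAll (j : Fin 5) (t : ℕ → Bool) :
    MvPolynomial (Fin 5) K →ₐ[K] MvPolynomial (Fin 5) K :=
  (transl K 0 (cK K (t 0 && !(0 == j.val)))).comp <|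
    (transl K 1 (cK K (t 1 && !(1 == j.val)))).comp <|
      (transl K 2 (cK K (t 2 && !(2 == j.val)))).comp <|
        (transl K 3 (cK K (t 3 && !(3 == j.val)))).comp
          (transl K 4 (cK K (t 4 && !(4 == j.val))))

variable {K}

/-- A monomial with coefficient `1` is the product of the powers of the variables. [folklore] -/
theorem monomial_one_eq_prod_X_pow_univ (d : Fin 5 →₀ ℕ) :
    monomial d (1 : K) = ∏ l, (X l : MvPolynomial (Fin 5) K) ^ d l := by
  rw [monomial_eq, C_1, one_mul, Finsupp.prod_fintype]
  intro i; exact pow_zero _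

/-- Splitting off the `i`-th variable from the product of powers after resetting its exponent.
[folklore] -/
theorem prod_X_pow_set (e : E5) (i : Fin 5) (n : ℕ) :
    (∏ l, (X l : MvPolynomial (Fin 5) K) ^ (e.set i.val n).toF l) =
      X i ^ n * ∏ l ∈ univ.erase i, (X l : MvPolynomial (Fin 5) K) ^ e.toF l := by
  rw [← Finset.mul_prod_erase univ _ (mem_univ i), E5.toF_set_apply, if_pos rfl]
  congr 1
  apply Finset.prod_congr rfl
  intro l hl
  rw [E5.toF_set_apply, if_neg (ne_of_mem_erase hl)]

/-- The translation on a monomial. [folklore] -/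
theorem transl_monomial (i : Fin 5) (c : K) (d : Fin 5 →₀ ℕ) :
    transl K i c (monomial d 1) =
      (X i + C c) ^ d i * ∏ l ∈ univ.erase i, (X l : MvPolynomial (Fin 5) K) ^ d l := by
  rw [monomial_one_eq_prod_X_pow_univ, map_prod, ← Finset.mul_prod_erase univ _ (mem_univ i)]
  simp only [map_pow, transl, aeval_X, ↓reduceIte]
  congr 1
  apply Finset.prod_congr rfl
  intro l hl
  rw [if_neg (ne_of_mem_erase hl)]

/-- Translating by `0` does nothing (on denotations of lists). [folklore] -/
theorem transl_zero_evalL (i : Fin 5) (L : List E5) : transl K i 0 (evalL K L) = evalL K L := by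
  induction L with
  | nil => simp
  | cons e L ih =>
    rw [evalL_cons, map_add, ih, transl_monomial, C_0, add_zero, monomial_one_eq_prod_X_pow_univ,
      Finset.mul_prod_erase univ (fun l => (X l : MvPolynomial (Fin 5) K) ^ e.toF l) (mem_univ i)]

/-- **Translating a monomial by `1` in characteristic `2`** is the list expansion by `bitSubsets`.
[folklore] -/
theorem transl_one_monomial_toF [CharP K 2] (i : Fin 5) (e : E5) :
    transl K i 1 (monomial e.toF 1) =
      evalL K ((bitSubsets (e.get i.val) (e.get i.val)).map (e.set i.val)) := by
  rw [transl_monomial, C_1, ← E5.toF_apply,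
    add_one_pow_eq_sum_bitSubsets (X i) (e.toF i) (e.toF i) Nat.lt_two_pow_self, evalL_map,
    ← List.sum_map_mul_right]
  congr 1
  apply List.map_congr_left
  intro k _
  rw [monomial_one_eq_prod_X_pow_univ, prod_X_pow_set]

/-- The chart's monomial substitution on a monomial: `x^e ↦ x_j^{|e|} ∏_{l ≠ j} x_l^{e_l}`.
[cite: HauserPerlega2019, §2] -/
theorem scaleHom_monomial_toF (j : Fin 5) (e : E5) :
    scaleHom K j (monomial e.toF 1) = monomial (e.set j.val e.deg).toF 1 := by
  rw [monomial_one_eq_prod_X_pow_univ, monomial_one_eq_prod_X_pow_univ, prod_X_pow_set, map_prod,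
    ← Finset.mul_prod_erase univ _ (mem_univ j)]
  simp only [map_pow, scaleHom, aeval_X, ↓reduceIte]
  have h : ∏ l ∈ univ.erase j, (if l = j then X j else X j * X l : MvPolynomial (Fin 5) K) ^ e.toF l
      = ∏ l ∈ univ.erase j, ((X j : MvPolynomial (Fin 5) K) ^ e.toF l * X l ^ e.toF l) := by
    apply Finset.prod_congr rfl
    intro l hl
    rw [if_neg (ne_of_mem_erase hl), mul_pow]
  rw [h, Finset.prod_mul_distrib, Finset.prod_pow_eq_pow_sum, ← mul_assoc, ← pow_add]
  congr 2
  rw [← E5.degree_toF, Finsupp.degree_eq_sum, Finset.add_sum_erase univ _ (mem_univ j)]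

/-- The effect of all translations on a variable. [folklore] -/
theorem translAll_X (j : Fin 5) (t : ℕ → Bool) (l : Fin 5) :
    translAll K j t (X l) = X l + C (cK K (t l.val && !(l.val == j.val))) := by
  fin_cases l <;> simp [translAll, transl, MvPolynomial.algebraMap_eq]

/-- **The point blow-up factors** as "monomial substitution, then translations".
[cite: HauserPerlega2019, §2 (form of `π`)] -/
theorem aeval_pointBlowupSubst_eq_translAll_scaleHom (j : Fin 5) (t : ℕ → Bool)
    (P : MvPolynomial (Fin 5) K) :
    aeval (pointBlowupSubst j (tK K t)) P = translAll K j t (scaleHom K j P) := by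
  suffices h : aeval (pointBlowupSubst j (tK K t)) = (translAll K j t).comp (scaleHom K j) from
    congr($h P)
  apply MvPolynomial.algHom_ext
  intro l
  simp only [AlgHom.comp_apply, aeval_X, scaleHom, pointBlowupSubst]
  by_cases h : l = j
  · subst h
    simp [translAll_X, cK]
  · have h' : (l.val == j.val) = false := by
      rw [beq_eq_false_iff_ne]; exact fun hv => h (Fin.ext hv)
    simp [h, translAll_X, map_mul, cK, tK, h']

/-! ### Correctness of the list operations -/

/-- `expandCoord` is translation by `1` (characteristic `2`). [folklore] -/
theorem evalL_expandCoord [CharP K 2] (i : Fin 5) (L : List E5) :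
    evalL K (expandCoord i L) = transl K i 1 (evalL K L) := by
  induction L with
  | nil => simp [expandCoord]
  | cons e L ih => rw [expandCoord, evalL_append, evalL_cons, map_add, transl_one_monomial_toF, ih]

/-- `procCoord` is translation by `0` or `1`. [folklore] -/
theorem evalL_procCoord [CharP K 2] (i : Fin 5) (b : Bool) (L : List E5) :
    evalL K (procCoord i b L) = transl K i (cK K b) (evalL K L) := by
  cases b
  · simp [procCoord, cK, transl_zero_evalL]
  · simp [procCoord, cK, evalL_expandCoord]

/-- `translList` performs all translations. [folklore] -/
theorem evalL_translList [CharP K 2] (j : Fin 5) (t : ℕ → Bool) (L : List E5) :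
    evalL K (translList j t L) = translAll K j t (evalL K L) := by
  simp only [translList, translAll, AlgHom.comp_apply, evalL_procCoord]

/-- `scaleList` is the chart's monomial substitution. [folklore] -/
theorem evalL_scaleList (j : Fin 5) (L : List E5) :
    evalL K (scaleList j L) = scaleHom K j (evalL K L) := by
  induction L with
  | nil => simp [scaleList]
  | cons e L ih =>
    rw [scaleList, List.map_cons, evalL_cons, evalL_cons, map_add, scaleHom_monomial_toF]
    congr 1

/-- **`transformList` computes the total transform** `π(F)`. [cite: HauserPerlega2019, §2] -/
theorem evalL_transformList [CharP K 2] (j : Fin 5) (t : ℕ → Bool) (L : List E5) :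
    evalL K (transformList j t L) = totalTransform j (tK K t) (evalL K L) := by
  rw [totalTransform, aeval_pointBlowupSubst_eq_translAll_scaleHom, transformList, evalL_translList,
    evalL_scaleList]

/-- **`divList` computes `divMonomial`.** [folklore] -/
theorem evalL_divList (s : E5) (L : List E5) :
    evalL K (divList s L) = MvPolynomial.divMonomial (evalL K L) s.toF := by
  ext m
  rw [coeff_divMonomial, coeff_evalL, coeff_evalL, divList, List.countP_map, List.countP_filter]
  congr 1
  apply List.countP_congr
  intro e _
  simp only [Function.comp_apply, Bool.and_eq_true, decide_eq_true_eq]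
  rw [E5.toF_eq_add_iff, and_comm]

/-- **`cleanList` computes `deletePthPowers`.** [cite: HauserPerlega2019, §2 (cleaning)] -/
theorem evalL_cleanList (q : ℕ) (L : List E5) :
    evalL K (cleanList q L) = deletePthPowers q (evalL K L) := by
  ext m
  rw [coeff_deletePthPowers, coeff_evalL, coeff_evalL, cleanList, List.countP_filter]
  split_ifs with h
  · have h0 : (L.countP fun e => decide (e.toF = m) && !E5.isPth q e) = 0 := by
      rw [List.countP_eq_zero]
      intro e _
      simp only [Bool.and_eq_true, decide_eq_true_eq, Bool.not_eq_true', not_and]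
      intro hem
      rw [← hem, ← E5.isPth_eq_true_iff] at h
      simp [h]
    rw [h0, Nat.cast_zero]
  · congr 1
    apply List.countP_congr
    intro e _
    simp only [Bool.and_eq_true, decide_eq_true_eq, Bool.not_eq_true', and_iff_left_iff_imp]
    intro hem
    rw [← hem, ← E5.isPth_eq_true_iff] at h
    simpa using h

/-- **One blow-up step on lists is one step of the point blow-up sequence**:
`evalL (stepList q j t L) = (x_j^{-q} · π(evalL L))_clean`. [cite: HauserPerlega2019, §2] -/
theorem evalL_stepList [CharP K 2] (q : ℕ) (j : Fin 5) (t : ℕ → Bool) (L : List E5) :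
    evalL K (stepList q j t L) =
      deletePthPowers q (transformResidual q j (tK K t) (evalL K L)) := by
  rw [stepList, evalL_cleanList, evalL_divList, E5.toF_unitVec, evalL_transformList,
    transformResidual]

/-! ### Reading orders off a list -/

/-- `deletePthPowers` always returns a clean polynomial (local copy of
`isClean_deletePthPowers` of `ResidualOrderUnboundedBlowup.lean`, to keep this file independent
of that toolkit). [cite: HauserPerlega2019, §2 (cleaning)] -/
private theorem isClean_deletePthPowers_local {σ : Type*} (q : ℕ) (P : MvPolynomial σ K) :
    IsClean q (deletePthPowers q P) := by
  classical
  intro d hd h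
  rw [MvPolynomial.mem_support_iff, coeff_deletePthPowers, if_pos h] at hd
  exact hd rfl

/-- A lower bound for the order from the degrees of the entries. [folklore] -/
theorem le_ordZero_evalL (L : List E5) (n : ℕ) (h : ∀ e ∈ L, n ≤ e.deg) :
    (n : ℕ∞) ≤ ordZero (evalL K L) := by
  unfold ordZero
  apply MvPowerSeries.nat_le_order
  intro d hd
  rw [MvPolynomial.coeff_coe]
  by_contra hne
  obtain ⟨e, he, rfl⟩ := exists_mem_of_mem_support_evalL (MvPolynomial.mem_support_iff.2 hne)
  rw [E5.degree_toF] at hd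
  exact absurd (h e he) (not_le.2 (by exact_mod_cast hd))

/-- A list without `q`-th power monomials denotes a clean polynomial. [cite: HauserPerlega2019, §2] -/
theorem isClean_evalL (q : ℕ) (L : List E5) (h : ∀ e ∈ L, e.isPth q = false) :
    IsClean q (evalL K L) := by
  intro d hd
  obtain ⟨e, he, rfl⟩ := exists_mem_of_mem_support_evalL hd
  rw [← E5.isPth_eq_true_iff, h e he]
  exact Bool.false_ne_true

end Semantics

/-! ### Generic bounds for `ordAlong` and `residualOrder` -/

section ResidualBounds

variable {σ : Type*} {K : Type*} [CommRing K]

/-- `ord_{(xᵢ)} F` is at most the `xᵢ`-exponent of any monomial of `F`. [folklore] -/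
theorem ordAlong_le_apply_of_mem_support {F : MvPolynomial σ K} {d : σ →₀ ℕ}
    (hd : d ∈ F.support) (i : σ) : ordAlong i F ≤ d i := by
  unfold ordAlong
  exact Finset.inf_le (f := fun d : σ →₀ ℕ => ((d i : ℕ) : ℕ∞)) hd

/-- `ord_{(xᵢ)} F ≥ n` if every monomial of `F` has `xᵢ`-exponent `≥ n`. [folklore] -/
theorem natCast_le_ordAlong_of_forall_mem_support {F : MvPolynomial σ K} (i : σ) (n : ℕ)
    (h : ∀ d ∈ F.support, n ≤ d i) : (n : ℕ∞) ≤ ordAlong i F :=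
  Finset.le_inf fun d hd => by exact_mod_cast h d hd

/-- The degree of the exceptional exponent is the sum of the `ord_{(xᵢ)} F`, `i ∈ Δ`. [folklore] -/
theorem degree_exceptionalExp_eq_sum_toNat (Δ : Finset σ) (F : MvPolynomial σ K) :
    (exceptionalExp Δ F).degree = ∑ i ∈ Δ, (ordAlong i F).toNat := by
  rw [exceptionalExp, map_sum]
  apply Finset.sum_congr rfl
  intro i _
  rw [map_nsmul, Finsupp.degree_single, smul_eq_mul, mul_one]

/-- The exceptional exponent at `i ∈ Δ`. [folklore] -/
theorem exceptionalExp_apply_eq_toNat_of_mem [DecidableEq σ] {Δ : Finset σ}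
    (F : MvPolynomial σ K) {i : σ} (hi : i ∈ Δ) :
    exceptionalExp Δ F i = (ordAlong i F).toNat := by
  rw [exceptionalExp, Finsupp.finsetSum_apply, Finset.sum_eq_single i]
  · simp
  · intro l _ hli; simp [hli]
  · intro h; exact absurd hi h

/-- The exceptional exponent vanishes off `Δ`. [folklore] -/
theorem exceptionalExp_apply_eq_zero_of_not_mem [DecidableEq σ] {Δ : Finset σ}
    (F : MvPolynomial σ K) {i : σ} (hi : i ∉ Δ) : exceptionalExp Δ F i = 0 := by
  rw [exceptionalExp, Finsupp.finsetSum_apply]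
  apply Finset.sum_eq_zero
  intro l hl
  have : l ≠ i := fun h => hi (h ▸ hl)
  simp [this]

/-- The exceptional monomial divides every monomial of `F`. [folklore] -/
theorem exceptionalExp_le_exponent_of_mem_support [DecidableEq σ] (Δ : Finset σ)
    {F : MvPolynomial σ K} {d : σ →₀ ℕ} (hd : d ∈ F.support) : exceptionalExp Δ F ≤ d := by
  intro i
  by_cases hi : i ∈ Δ
  · rw [exceptionalExp_apply_eq_toNat_of_mem F hi]
    have h := ordAlong_le_apply_of_mem_support hd i
    have hne : ordAlong i F ≠ ⊤ := ne_top_of_le_ne_top (ENat.coe_ne_top _) h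
    rw [← ENat.coe_toNat hne] at h
    exact_mod_cast h
  · rw [exceptionalExp_apply_eq_zero_of_not_mem F hi]; exact Nat.zero_le _

/-- **Lower bound for the residual order**: if `ord_{(xᵢ)} F ≤ ρᵢ` on `Δ` and every monomial of
`F` has degree `≥ m + Σ_{i∈Δ} ρᵢ`, then `residual order ≥ m`. [folklore] -/
theorem natCast_le_residualOrder_of_bounds [DecidableEq σ] {Δ : Finset σ} {F : MvPolynomial σ K}
    (ρ : σ → ℕ) (m : ℕ) (hρ : ∀ i ∈ Δ, ordAlong i F ≤ ρ i)
    (hdeg : ∀ d ∈ F.support, m + ∑ i ∈ Δ, ρ i ≤ d.degree) :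
    (m : ℕ∞) ≤ residualOrder Δ F := by
  unfold residualOrder residualFactor ordZero
  apply MvPowerSeries.nat_le_order
  intro d' hd'
  rw [MvPolynomial.coeff_coe, coeff_divMonomial]
  by_contra hne
  have hmem : exceptionalExp Δ F + d' ∈ F.support := MvPolynomial.mem_support_iff.2 hne
  have h1 := hdeg _ hmem
  rw [map_add, degree_exceptionalExp_eq_sum_toNat] at h1
  have h2 : ∑ i ∈ Δ, (ordAlong i F).toNat ≤ ∑ i ∈ Δ, ρ i := by
    apply Finset.sum_le_sum
    intro i hi
    exact ENat.toNat_le_of_le_coe (hρ i hi)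
  have h3 : d'.degree < m := by exact_mod_cast hd'
  omega

/-- **Upper bound for the residual order**: if every monomial of `F` has `xᵢ`-exponent `≥ ρᵢ`
on `Δ` and some monomial of `F` has degree `≤ m + Σ_{i∈Δ} ρᵢ`, then `residual order ≤ m`.
[folklore] -/
theorem residualOrder_le_natCast_of_witness [DecidableEq σ] {Δ : Finset σ} {F : MvPolynomial σ K}
    (ρ : σ → ℕ) (m : ℕ) (hρ : ∀ i ∈ Δ, ∀ d ∈ F.support, ρ i ≤ d i)
    {d : σ →₀ ℕ} (hd : d ∈ F.support) (hdeg : d.degree ≤ m + ∑ i ∈ Δ, ρ i) :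
    residualOrder Δ F ≤ m := by
  unfold residualOrder residualFactor ordZero
  set r := exceptionalExp Δ F with hr
  have hrd : r ≤ d := exceptionalExp_le_exponent_of_mem_support Δ hd
  have hcoeff : MvPowerSeries.coeff (d - r) (↑(MvPolynomial.divMonomial F r) :
      MvPowerSeries σ K) ≠ 0 := by
    rw [MvPolynomial.coeff_coe, coeff_divMonomial, add_tsub_cancel_of_le hrd]
    exact MvPolynomial.mem_support_iff.1 hd
  refine (MvPowerSeries.order_le hcoeff).trans ?_
  have hsum : ∑ i ∈ Δ, ρ i ≤ r.degree := by
    rw [hr, degree_exceptionalExp_eq_sum_toNat]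
    apply Finset.sum_le_sum
    intro i hi
    have h := natCast_le_ordAlong_of_forall_mem_support (F := F) i (ρ i) (hρ i hi)
    have hne : ordAlong i F ≠ ⊤ :=
      ne_top_of_le_ne_top (ENat.coe_ne_top _) (ordAlong_le_apply_of_mem_support hd i)
    rw [← ENat.coe_toNat hne] at h
    exact_mod_cast h
  have hdeg' : (d - r).degree + r.degree = d.degree := by
    rw [← map_add, tsub_add_cancel_of_le hrd]
  have : (d - r).degree ≤ m := by omega
  exact_mod_cast this

end ResidualBounds

/-! ## Certified residual orders of list polynomials -/

namespace E5

/-- `Σ_{i : δ i} ρᵢ`, the degree of `ρ` on the coordinates selected by the mask `δ`. [folklore] -/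
def maskDeg (δ : ℕ → Bool) (ρ : E5) : ℕ :=
  (bif δ 0 then ρ.x else 0) + (bif δ 1 then ρ.y else 0) + (bif δ 2 then ρ.u else 0) +
    (bif δ 3 then ρ.v else 0) + (bif δ 4 then ρ.w else 0)

/-- `maskDeg` is the sum of the selected exponents. [folklore] -/
theorem sum_filter_toF (δ : ℕ → Bool) (ρ : E5) :
    ∑ i ∈ Finset.univ.filter (fun i : Fin 5 => δ i.val = true), ρ.toF i = ρ.maskDeg δ := by
  rw [Finset.sum_filter, Fin.sum_univ_five]
  simp [maskDeg, Bool.cond_eq_ite]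

end E5

section Certificate

variable {K : Type*} [CommRing K]

/-- **Residual order from a list certificate.** For `F = evalL L` and `Δ = {i : δ i}`: if every
entry `e` of `L` has `deg e ≥ m + Σ_{i∈Δ} ρᵢ` and `e ≥ ρ` componentwise, if for each `i ∈ Δ` some
entry occurring exactly once has `i`-th exponent `ρᵢ`, and some entry occurring exactly once has
degree `≤ m + Σ_{i∈Δ} ρᵢ`, then the residual order of `F` w.r.t. `Δ` is `m` (and `x^ρ` is the
exceptional monomial). [folklore] -/
theorem residualOrder_evalL_eq_of_cert [Nontrivial K] (δ : ℕ → Bool) (L : List E5) (ρ : E5)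
    (m : ℕ) (wit : ℕ → E5) (w : E5)
    (hL : ∀ e ∈ L, m + ρ.maskDeg δ ≤ e.deg ∧ ρ.ble e = true)
    (hwit : ∀ i < 5, δ i = true → L.count (wit i) = 1 ∧ (wit i).get i = ρ.get i)
    (hw : L.count w = 1 ∧ w.deg ≤ m + ρ.maskDeg δ) :
    residualOrder (Finset.univ.filter fun i : Fin 5 => δ i.val = true) (evalL K L) = m := by
  have hsum := E5.sum_filter_toF δ ρ
  apply le_antisymm
  · refine residualOrder_le_natCast_of_witness (fun i => ρ.toF i) m ?_ (toF_mem_support_evalL hw.1) ?_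
    · intro i _ d hd
      obtain ⟨e, he, rfl⟩ := exists_mem_of_mem_support_evalL hd
      exact (E5.ble_eq_true_iff e ρ).1 (hL e he).2 i
    · rw [E5.degree_toF, hsum]; exact hw.2
  · refine natCast_le_residualOrder_of_bounds (fun i => ρ.toF i) m ?_ ?_
    · intro i hi
      rw [Finset.mem_filter] at hi
      obtain ⟨hc, hget⟩ := hwit i.val i.isLt hi.2
      refine (ordAlong_le_apply_of_mem_support (toF_mem_support_evalL (K := K) hc) i).trans ?_
      rw [E5.toF_apply, E5.toF_apply, hget]
    · intro d hd
      obtain ⟨e, he, rfl⟩ := exists_mem_of_mem_support_evalL hd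
      rw [E5.degree_toF, hsum]; exact (hL e he).1

end Certificate

/-! ## The data of the blow-up sequence -/

/-- The charts: `x, x, u, v, w, u, y, y, y, y, x` for the blow-ups `0, …, 10`, then `v` forever
(variables `x, y, u, v, w = 0, …, 4`). [cite: HauserPerlega2019, §4 (First example, (1)–(7))] -/
def cycleChart (k : ℕ) : Fin 5 := ([0, 0, 2, 3, 4, 2, 1, 1, 1, 1, 0] : List (Fin 5)).getD k 3

/-- The translations: `y ↦ y + 1` at blow-up `0` (HP (1)), `y ↦ y + 1, v ↦ v + 1` at blow-up `4`
(HP (5)), `u ↦ u + 1` at blow-up `10` (HP (1) of the next cycle, `y` and `u` exchanged), none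
otherwise. [cite: HauserPerlega2019, §4 (First example, (1) and (5))] -/
def cycleTransl (k : ℕ) : ℕ → Bool :=
  ([fun i => i == 1, fun _ => false, fun _ => false, fun _ => false, fun i => i == 1 || i == 3,
    fun _ => false, fun _ => false, fun _ => false, fun _ => false, fun _ => false,
    fun i => i == 2] : List (ℕ → Bool)).getD k fun _ => false

/-- The starting polynomial `F⁰ = x⁴y⁴w⁸ + x¹⁷y⁴w⁶ = x⁴y⁴w⁶ · (w² + x¹³)` (HP (0) with `d = 2`,
`a = b = r = 0`, `s = 1`, `λ = 1`, `Q = 0`, and `x^{d+1}u^{2d+6}A` specialised to `x¹³`).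
[cite: HauserPerlega2019, §4 (First example, (0))] -/
def cycleStart : List E5 := [⟨4, 4, 0, 0, 8⟩, ⟨17, 4, 0, 0, 6⟩]

/-- The lists `L_k`: `L_{k+1} = stepList 8 j_k t_k L_k`. [cite: HauserPerlega2019, §2 and §4] -/
def cycleList : ℕ → List E5
  | 0 => cycleStart
  | k + 1 => stepList 8 (cycleChart k) (cycleTransl k) (cycleList k)

/-- Boolean mirror of the exceptional sets: `Δ₀ =` all, `Δ_{k+1} = {j_k} ∪ {i ∈ Δ_k : t_k i = 0}`.
[cite: HauserPerlega2019, §2 (the set B)] -/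
def cycleExcB : ℕ → ℕ → Bool
  | 0 => fun _ => true
  | k + 1 => fun i => i == (cycleChart k).val || (cycleExcB k i && !(cycleTransl k i))

/-- Certificate data: the residual orders `2, 6, 5, 5, 5, 5, 4, 4, 4, 4, 4, 8` of `F⁰, …, F¹¹`
(`d, d+4, d+3, d+3, d+3, d+3, d+2, …, d+2, (d+2)+4` for `d = 2`).
[cite: HauserPerlega2019, §4 (First example: "increased to d+4", "decreased to d+3", "decreased to d+2")] -/
def certOrder (k : ℕ) : ℕ := ([2, 6, 5, 5, 5, 5, 4, 4, 4, 4, 4, 8] : List ℕ).getD k 0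

/-- Certificate data: the exceptional exponents `r = (ord_{(xᵢ)} F^k)_{i ∈ Δ_k}` of `F⁰, …, F¹¹`.
[cite: HauserPerlega2019, §4 (First example)] -/
def certExc (k : ℕ) : E5 :=
  ([⟨4, 4, 0, 0, 6⟩, ⟨8, 0, 0, 0, 6⟩, ⟨12, 0, 0, 0, 6⟩, ⟨12, 0, 15, 0, 6⟩, ⟨12, 0, 15, 30, 6⟩,
    ⟨12, 0, 15, 0, 60⟩, ⟨12, 0, 84, 0, 60⟩, ⟨12, 152, 84, 0, 60⟩, ⟨12, 304, 84, 0, 60⟩,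
    ⟨12, 456, 84, 0, 60⟩, ⟨12, 608, 84, 0, 60⟩, ⟨760, 608, 0, 0, 60⟩] : List E5).getD k ⟨0, 0, 0, 0, 0⟩

/-- Certificate data: a monomial of `F^k` of minimal degree (it occurs exactly once).
[cite: HauserPerlega2019, §4 (First example)] -/
def certMin (k : ℕ) : E5 :=
  ([⟨4, 4, 0, 0, 8⟩, ⟨8, 4, 0, 0, 8⟩, ⟨17, 0, 0, 0, 6⟩, ⟨17, 0, 15, 0, 6⟩, ⟨17, 0, 15, 30, 6⟩,
    ⟨12, 0, 16, 0, 64⟩, ⟨12, 0, 84, 0, 64⟩, ⟨12, 152, 84, 0, 64⟩, ⟨12, 304, 84, 0, 64⟩,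
    ⟨12, 456, 84, 0, 64⟩, ⟨12, 608, 84, 0, 64⟩, ⟨760, 608, 4, 0, 64⟩] : List E5).getD k ⟨0, 0, 0, 0, 0⟩

/-- Certificate data: for `i ∈ Δ_k`, a monomial of `F^k` with minimal `xᵢ`-exponent (it occurs
exactly once). [cite: HauserPerlega2019, §4 (First example)] -/
def certWit (k i : ℕ) : E5 :=
  (([[⟨4, 4, 0, 0, 8⟩, ⟨4, 4, 0, 0, 8⟩, ⟨4, 4, 0, 0, 8⟩, ⟨4, 4, 0, 0, 8⟩, ⟨17, 4, 0, 0, 6⟩],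
    [⟨8, 4, 0, 0, 8⟩, ⟨0, 0, 0, 0, 0⟩, ⟨8, 4, 0, 0, 8⟩, ⟨8, 4, 0, 0, 8⟩, ⟨19, 0, 0, 0, 6⟩],
    [⟨12, 4, 0, 0, 8⟩, ⟨0, 0, 0, 0, 0⟩, ⟨12, 4, 0, 0, 8⟩, ⟨12, 4, 0, 0, 8⟩, ⟨17, 0, 0, 0, 6⟩],
    [⟨12, 4, 16, 0, 8⟩, ⟨0, 0, 0, 0, 0⟩, ⟨17, 0, 15, 0, 6⟩, ⟨12, 4, 16, 0, 8⟩, ⟨17, 0, 15, 0, 6⟩],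
    [⟨12, 4, 16, 32, 8⟩, ⟨0, 0, 0, 0, 0⟩, ⟨17, 0, 15, 30, 6⟩, ⟨17, 0, 15, 30, 6⟩, ⟨17, 0, 15, 30, 6⟩],
    [⟨12, 0, 16, 0, 64⟩, ⟨0, 0, 0, 0, 0⟩, ⟨17, 0, 15, 0, 60⟩, ⟨0, 0, 0, 0, 0⟩, ⟨17, 0, 15, 0, 60⟩],
    [⟨12, 0, 84, 0, 64⟩, ⟨0, 0, 0, 0, 0⟩, ⟨12, 0, 84, 0, 64⟩, ⟨0, 0, 0, 0, 0⟩, ⟨17, 0, 84, 0, 60⟩],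
    [⟨12, 152, 84, 0, 64⟩, ⟨12, 152, 84, 0, 64⟩, ⟨12, 152, 84, 0, 64⟩, ⟨0, 0, 0, 0, 0⟩,
      ⟨17, 153, 84, 0, 60⟩],
    [⟨12, 304, 84, 0, 64⟩, ⟨12, 304, 84, 0, 64⟩, ⟨12, 304, 84, 0, 64⟩, ⟨0, 0, 0, 0, 0⟩,
      ⟨17, 306, 84, 0, 60⟩],
    [⟨12, 456, 84, 0, 64⟩, ⟨12, 456, 84, 0, 64⟩, ⟨12, 456, 84, 0, 64⟩, ⟨0, 0, 0, 0, 0⟩,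
      ⟨17, 459, 84, 0, 60⟩],
    [⟨12, 608, 84, 0, 64⟩, ⟨12, 608, 84, 0, 64⟩, ⟨12, 608, 84, 0, 64⟩, ⟨0, 0, 0, 0, 0⟩,
      ⟨17, 612, 84, 0, 60⟩],
    [⟨760, 608, 4, 0, 64⟩, ⟨760, 608, 4, 0, 64⟩, ⟨0, 0, 0, 0, 0⟩, ⟨0, 0, 0, 0, 0⟩,
      ⟨765, 612, 0, 0, 60⟩]] : List (List E5)).getD k []).getD i ⟨0, 0, 0, 0, 0⟩

/-! ## Kernel computations -/

/-- `F⁰` is clean. [cite: HauserPerlega2019, §4] -/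
theorem cycleStart_isPth : ∀ e ∈ cycleStart, e.isPth 8 = false := by decide

/-- Every monomial of `F⁰, …, F¹¹` has degree `≥ 8`. [cite: HauserPerlega2019, §4] -/
theorem cycleList_deg_ge : ∀ k < 12, ∀ e ∈ cycleList k, 8 ≤ e.deg := by decide +kernel

/-- Every monomial of `F¹¹` (`606` of them) has `x`-exponent `≥ 8`. [cite: HauserPerlega2019, §4] -/
theorem cycleList_eleven_x_ge :
    (∀ e ∈ cycleList 11, 8 ≤ e.x) ∧ (cycleList 11).length = 606 := by
  decide +kernel

/-- **The residual-order certificates of `F⁰, …, F¹¹` check** (kernel computation).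
[cite: HauserPerlega2019, §4 (First example)] -/
theorem cycle_certificates : ∀ k < 12,
    (∀ e ∈ cycleList k, certOrder k + (certExc k).maskDeg (cycleExcB k) ≤ e.deg ∧
      (certExc k).ble e = true) ∧
    (∀ i < 5, cycleExcB k i = true →
      (cycleList k).count (certWit k i) = 1 ∧ (certWit k i).get i = (certExc k).get i) ∧
    ((cycleList k).count (certMin k) = 1 ∧
      (certMin k).deg ≤ certOrder k + (certExc k).maskDeg (cycleExcB k)) := by
  decide +kernel

section Sequence

variable (K : Type*) [CommRing K]

/-- The polynomials `F^k` of the sequence. [cite: HauserPerlega2019, §4 (First example)] -/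
noncomputable def cycleF (k : ℕ) : MvPolynomial (Fin 5) K := evalL K (cycleList k)

/-- The translation vectors `t_k ∈ {0,1}⁵`. [cite: HauserPerlega2019, §4 (First example)] -/
def cycleT (k : ℕ) : Fin 5 → K := tK K (cycleTransl k)

/-- The exceptional sets `Δ_k`, by the printed rule, starting from `E = V(xyuvw)`.
[cite: HauserPerlega2019, §2 and §4] -/
noncomputable def cycleExc : ℕ → Finset (Fin 5)
  | 0 => Finset.univ
  | k + 1 => newExceptional (cycleExc k) (cycleChart k) (cycleT K k)

variable {K}

/-- From blow-up `11` on the chart is `v`. [folklore] -/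
theorem cycleChart_of_le {k : ℕ} (hk : 11 ≤ k) : cycleChart k = 3 := by
  unfold cycleChart
  exact List.getD_eq_default _ _ (by simpa using hk)

/-- From blow-up `11` on there is no translation. [folklore] -/
theorem cycleTransl_of_le {k : ℕ} (hk : 11 ≤ k) : cycleTransl k = fun _ => false := by
  unfold cycleTransl
  exact List.getD_eq_default _ _ (by simpa using hk)

/-- The exceptional sets agree with their Boolean mirror. [folklore] -/
theorem mem_cycleExc_iff [Nontrivial K] (k : ℕ) (i : Fin 5) :
    i ∈ cycleExc K k ↔ cycleExcB k i.val = true := by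
  induction k generalizing i with
  | zero => simp [cycleExc, cycleExcB]
  | succ k ih =>
    simp only [cycleExc, newExceptional, Finset.mem_insert, Finset.mem_filter, ih, cycleExcB,
      Bool.or_eq_true, beq_iff_eq, Bool.and_eq_true, Bool.not_eq_true', cycleT, tK, cK,
      ite_eq_right_iff, one_ne_zero, imp_false, Bool.not_eq_true, Fin.val_inj]
    by_cases h : i = cycleChart k <;> simp [h]

/-- The exceptional sets as filters of their Boolean mirror. [folklore] -/
theorem cycleExc_eq_filter [Nontrivial K] (k : ℕ) :
    cycleExc K k = Finset.univ.filter fun i : Fin 5 => cycleExcB k i.val = true := by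
  ext i
  simp [mem_cycleExc_iff]

/-- `Δ₁₁ = {x, y, w}`. [cite: HauserPerlega2019, §4 (First example)] -/
theorem cycleExc_eleven [Nontrivial K] : cycleExc K 11 = {0, 1, 4} := by
  ext i
  rw [mem_cycleExc_iff]
  fin_cases i <;> decide

/-! ## The tail: `v`-chart blow-ups keep the `x`-exponents -/

/-- A blow-up without translation in a chart other than `x` does not lower `x`-exponents.
[folklore] -/
theorem x_ge_of_mem_stepList (q n : ℕ) (j : Fin 5) (hj : j.val ≠ 0) (L : List E5)
    (h : ∀ e ∈ L, n ≤ e.x) : ∀ e ∈ stepList q j (fun _ => false) L, n ≤ e.x := by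
  intro e he
  simp only [stepList, transformList, translList, Bool.false_and, procCoord, cleanList, divList,
    scaleList, List.mem_filter, List.mem_map] at he
  obtain ⟨⟨e₁, ⟨⟨e₀, he₀, rfl⟩, -⟩, rfl⟩, -⟩ := he
  have hx : ((e₀.set j.val e₀.deg).sub (E5.unitVec j.val q)).x = e₀.x := by
    simp only [E5.sub, E5.unitVec, E5.x_set_of_ne_zero _ hj]
    rfl
  rw [hx]
  exact h e₀ he₀

/-- From `F¹¹` on every monomial keeps `x`-exponent `≥ 8`. [cite: HauserPerlega2019, §4] -/
theorem cycleList_x_ge (k : ℕ) (hk : 11 ≤ k) : ∀ e ∈ cycleList k, 8 ≤ e.x := by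
  induction k, hk using Nat.le_induction with
  | base => exact cycleList_eleven_x_ge.1
  | succ k hk ih =>
    rw [cycleList, cycleTransl_of_le hk]
    exact x_ge_of_mem_stepList 8 8 _ (by rw [cycleChart_of_le hk]; decide) _ ih

/-- `ord F^k ≥ 8` for all `k`: the order of `f = z⁸ + F^k` stays `8`. [cite: HauserPerlega2019, §4] -/
theorem le_ordZero_cycleF (k : ℕ) : (8 : ℕ∞) ≤ ordZero (cycleF K k) := by
  refine (by norm_num : (8 : ℕ∞) = ((8 : ℕ) : ℕ∞)) ▸ le_ordZero_evalL _ 8 ?_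
  by_cases hk : k < 12
  · exact cycleList_deg_ge k hk
  · intro e he
    have hx := cycleList_x_ge k (by omega) e he
    unfold E5.deg; omega

/-! ## The point blow-up sequence and its residual orders -/

/-- **The eleven blow-ups (and their continuation) form a point blow-up sequence** in the sense of
`IsPointBlowupSequence` with `q = pᵉ = 8`: all `F^k` clean of order `≥ 8`, `F^{k+1}` the cleaned
`F`-part of the strict transform, exceptional sets by the printed rule.
[cite: HauserPerlega2019, §2 and §4 (First example)] -/
theorem cycle_isPointBlowupSequence [CharP K 2] :
    IsPointBlowupSequence 8 (cycleF K) (cycleExc K) cycleChart (cycleT K) where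
  clean k := by
    cases k with
    | zero => exact isClean_evalL 8 _ cycleStart_isPth
    | succ k =>
      simp only [cycleF, cycleList, evalL_stepList]
      exact isClean_deletePthPowers_local _ _
  ord_le k := le_ordZero_cycleF k
  transform k := by simp only [cycleF, cycleList, evalL_stepList, cycleT]
  exceptional _ := rfl

/-- **The residual orders along the sequence**: `2, 6, 5, 5, 5, 5, 4, 4, 4, 4, 4, 8` for
`F⁰, …, F¹¹` w.r.t. `Δ₀, …, Δ₁₁` — `d = 2` rises to `d + 4` under blow-up (1), falls to `d + 3`
under (2) and to `d + 2` under (6), and rises to `(d + 2) + 4 = 8` under blow-up (1) of the next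
cycle. [cite: HauserPerlega2019, §4 (First example, (0)–(7))] -/
theorem residualOrder_cycleF [Nontrivial K] (k : ℕ) (hk : k < 12) :
    residualOrder (cycleExc K k) (cycleF K k) = certOrder k := by
  obtain ⟨hL, hwit, hw⟩ := cycle_certificates k hk
  rw [cycleExc_eq_filter]
  exact residualOrder_evalL_eq_of_cert (cycleExcB k) (cycleList k) (certExc k) (certOrder k)
    (certWit k) (certMin k) hL hwit hw

/-- **The residual order of `F⁰` w.r.t. `E = V(xyuvw)` is `d = 2`.**
[cite: HauserPerlega2019, §4 (First example, (0): "The residual order equals d")] -/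
theorem residualOrder_cycleF_zero [Nontrivial K] : residualOrder (cycleExc K 0) (cycleF K 0) = 2 :=
  residualOrder_cycleF 0 (by norm_num)

/-- **The residual order of `F¹¹` w.r.t. `E₁₁ = V(xyw)` is `8 = (d + 2) + 4`** — above Moh's
claimed bound `d + p^{e−1} = 6`. [cite: HauserPerlega2019, §3 and §4 (First example)] -/
theorem residualOrder_cycleF_eleven [Nontrivial K] :
    residualOrder (cycleExc K 11) (cycleF K 11) = 8 :=
  residualOrder_cycleF 11 (by norm_num)

end Sequence

/-! ## Headline: the bound `d + p^{e−1}` is exceeded; Moh's claim is false -/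

/-- **Over every commutative ring of characteristic `2` there is a point blow-up sequence
(`pᵉ = 2³`, `n = 5`) whose residual order is `2` at the start and `8 > 2 + 2^{3−1}` after eleven
blow-ups.** [cite: HauserPerlega2019, §3–§4 (First example)] -/
theorem exists_pointBlowupSequence_residualOrder_exceeds (K : Type) [CommRing K] [CharP K 2] :
    ∃ (F : ℕ → MvPolynomial (Fin 5) K) (Δ : ℕ → Finset (Fin 5)) (j : ℕ → Fin 5)
      (t : ℕ → Fin 5 → K), IsPointBlowupSequence (2 ^ 3) F Δ j t ∧
      residualOrder (Δ 0) (F 0) = 2 ∧ residualOrder (Δ 11) (F 11) = 8 := by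
  haveI : Nontrivial K := CharP.nontrivial_of_char_ne_one (R := K) (v := 2) (by norm_num)
  exact ⟨cycleF K, cycleExc K, cycleChart, cycleT K, (by norm_num : (2 : ℕ) ^ 3 = 8) ▸
    cycle_isPointBlowupSequence, residualOrder_cycleF_zero, residualOrder_cycleF_eleven⟩

/-- **Moh's Stability claim (as quoted by Hauser–Perlega and rendered as `MohStabilityClaim`) is
false** — unconditionally: over an algebraic closure of `𝔽₂`, with `p = 2`, `e = 3`, `n = 5`, the
sequence above has residual order `8` at stage `11`, exceeding `d + p^{e−1} = 2 + 4`. Compare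
`not_mohStabilityClaim`, which derives the same from the named fact `HauserPerlega2019`.
[cite: HauserPerlega2019, §3 ("This disproves Moh's claim in the case e ≥ 3") and §4 (First example)] -/
theorem mohStabilityClaim_false : ¬ MohStabilityClaim := by
  intro hM
  haveI : Fact (Nat.Prime 2) := ⟨Nat.prime_two⟩
  let K := AlgebraicClosure (ZMod 2)
  haveI : CharP K 2 := charP_of_injective_algebraMap (algebraMap (ZMod 2) K).injective 2
  obtain ⟨F, Δ, j, t, hseq, h0, h11⟩ := exists_pointBlowupSequence_residualOrder_exceeds K
  have hle := hM 2 3 5 K Nat.prime_two (by norm_num) F Δ j t hseq 11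
  rw [h0, h11] at hle
  have h' : ((8 : ℕ) : ℕ∞) ≤ ((2 + 2 ^ (3 - 1) : ℕ) : ℕ∞) := by
    push_cast
    exact_mod_cast hle
  exact absurd (by exact_mod_cast h') (by norm_num : ¬ ((8 : ℕ) ≤ 2 + 2 ^ (3 - 1)))

end HauserPerlega

end Literature.Barriers.ResolutionOfSingularities
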